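import Summits.ResolutionOfSingularities.ResolutionOfSingularities.Theses.TeissierJung
import Summits.ResolutionOfSingularities.ResolutionOfSingularities.Theorems.TeissierReduction.Negative.ImpliedBySummit
import Summits.ResolutionOfSingularities.ResolutionOfSingularities.Theorems.TeissierReduction.Negative.FalseWithoutIsIntegral
import Summits.ResolutionOfSingularities.ResolutionOfSingularities.Theorems.TeissierReduction.Negative.TeissierQuotientF2Point
import Summits.ResolutionOfSingularities.ResolutionOfSingularities.Theorems.TeissierReduction.Negative.FalseOverPerfectField
import Literature.AlgebraicGeometry.Resolution.TeissierPresentation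
import Literature.AlgebraicGeometry.Resolution.AlterationsFormalCoordinates
import Literature.AlgebraicGeometry.Motives.VarietiesProperProofs

/-!
# Disproof of `TeissierReduction` (crux stmt-ResolutionOfSingularities-17085, route `TeissierJung`)
# — findings of the crux-disprover seat (cycle 1, 2026-08-17)

VERDICT OF CYCLE 1: **no kill is possible for the item AS TYPED** — it is a formal consequence of
the summit (§2) — and the two cheap load-bearing facts are landed as Negative lemmas (§3). What a
disprover CAN usefully attack is the INTENDED statement (Jung's reduction with only the regular
base modified), typed in §4 as `TeissierReductionJung`; its hard regime is identified in §5.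

GEN 2, CYCLE 1 (2026-08-17): the remaining load-bearing hypothesis `IsAlgClosed k` is now SETTLED
IN LEAN — §3c's former near-miss `teissierReduction_false_over_F2` is proved (no `sorry` left in
this file) by the landed modules `Negative/TeissierQuotientF2Point.lean` (p157654: over `𝔽₂` every
Teissier quotient has an `𝔽₂`-point; closed points of a Teissier-presented scheme over `𝔽₂` are
`𝔽₂`-rational) and `Negative/FalseOverPerfectField.lean` (the crux with `[IsAlgClosed k]` ↦
`[PerfectField k]` is false: `k = 𝔽₂`, `H = ℙ¹`). §6 records what the proof does and does not
use, two further paper findings (finite type of `H` is load-bearing; over algebraically closed `k`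
no binomial of a datum is a pure power `u_i^{n_i} − c_i`), and the updated attack list.

## Findings (index)

1. `teissierReduction_iff` — the crux is `∀ p k m H …, ∃ X' ρ, IsProper ρ ∧ IsBirational ρ ∧
   TeissierPresented k X'` (the let-bound `TF` is the Literature predicate, `teissierPresented_iff`).
2. **Implied by the summit** (`teissierPresented_of_isRegular`,
   `exists_hypersurface_not_hasResolution_of_not_teissierReduction`,
   `not_resolutionOfSingularities_of_not_teissierReduction`; LANDING as
   `Theorems/TeissierReduction/Negative/ImpliedBySummit.lean`, p151409): the predicate `TF X'`
   holds for every REGULAR integral separated finite-type `X'` with the degenerate data `S := X'`,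
   `π := 𝟙`, `g := 0` (Cohen `𝒪̂_{X',x} ≅ k⟦x₁..x_d⟧` + the empty Teissier datum), so any
   resolution of `H` witnesses the crux, and a counterexample to the crux is an integral projective
   hypersurface over an algebraically closed field with NO resolution of singularities — i.e. a
   disproof of `ResolutionOfSingularities`. Consequences: (i) no surface / threefold computation
   can kill the item (resolution is known there: CossartPiltant2019, in tree as a named fact,
   `hasResolution_of_dim_le_three`); (ii) the route's printed KILL CRITERION ("a surface germ that no
   base modification makes Teissier closes the route refuted:TeissierReduction") is VOID for the
   typed item; (iii) the Jung square `X' = H ×_{ℙ^d} S`, `S → ℙ^d` a modification of the base of a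
   finite projection, is not mentioned by the type (concurring with grounder g75-0 and route-review
   rreview-0817T01-1, who found the same degenerate witness on paper).
3. **Load-bearing hypotheses** (§3): `IsIntegral H` IS load-bearing — weakened to `IsReduced H`
   the item is false (`teissierReduction_false_without_isIntegral`, witness `H = ∅ ↪ ℙ⁰`; LANDING
   as `Negative/FalseWithoutIsIntegral.lean`). The hypotheses `p.Prime`/`CharP`, `IsClosedImmersion
   ι'` into `ℙᵐ` (beyond "finite type, separated") and LOCAL PRINCIPALITY are DECORATION relative
   to the summit: `teissierReductionWithoutPrincipal_of_resolution` proves the item with the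
   hypersurface hypothesis deleted from the summit by the same degenerate witness (so a prover who
   uses local principality is using it for the Jung projection, not for the typed conclusion).
   `IsAlgClosed k` IS load-bearing (§3c, `teissierReduction_false_over_F2`, PROVED in gen 2 via
   `Negative/FalseOverPerfectField.lean`: over `𝔽₂` every Teissier quotient has an `𝔽₂`-point —
   augmentation plus primality of the binomial ideal — so closed points of a `TF` scheme are
   `𝔽₂`-rational, while any `X'` birational to `ℙ¹_{𝔽₂}` has closed points of degree `≥ 2`).
4. **The intended statement** `TeissierReductionJung` (§4, a `def`, NOT refuted, no theorem
   claimed): finite surjective `π₀ : H → ℙ^d`, a proper birational `σ : S → ℙ^d` with `S` regular,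
   and `X' := H ×_{ℙ^d} S` Teissier-presented OVER `S` (`TeissierPresentedOver`, the predicate `TF`
   with the base `S, π` given instead of existentially quantified). Refuting it = answering
   Mourtada–Schober's open question (C. R. Math. 363 (2025) p. 4) negatively.
5. **Regimes checked on paper against `TeissierReductionJung`** (none bites; details in §5):
   (a) `d = 1` (plane curves): every branch is an overweight deformation of its monomial curve
   (Teissier's original observation; complete DVRs are defectless) — holds. (b) radicial monomial
   covers `z^p = x^a y^b`: the barrier `Literature.Barriers.ResolutionOfSingularities.
   BaseOnlyRadicialNormalizationCannot` (golden valuation, `z¹¹ = s t⁴`) does NOT bite — at every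
   quadratic transform the germ `z^p − P^α Q^β` (`p ∤ α`) is ALREADY Teissier (`g = 1`, `h = 0`,
   prime binomial); the barrier forbids regularising by normalisation, which the Teissier programme
   never does. (c) purely inseparable degree `p`, `z^p + F(x₁,x₂)`: Teissier at a point iff, after
   removing `p`-th powers, `F = x^A·unit` with `p ∤ A`; base point blow-ups + cleaning reach this and
   it is STABLE under further blow-ups (if `p | α₁+α₂` at a translated point then `p ∤ α₂` and the
   cleaned germ is `x₁'^{α₁+α₂} x₂''·unit`) — consistent with Piltant 2003 Thm 7.1. (d) Artin–Schreier
   degree `p`, `z^p − x^B z − x^A` after monomialising both coefficients on the base: one vertex iff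
   `B/(p−1)` and `A/p` are comparable (reached by principalising `(x^{pB}, x^{(p−1)A})` on the base);
   if `A/p < B/(p−1)` the germ is Teissier with `g = 1` (the `z`-linear term is overweight); if
   `B/(p−1) < A/p` the Newton polygon has two slopes and `f` SPLITS over `k⟦x⟧` into a smooth branch
   and tame Kummer branches `z^m − ζ x^{B/δ}·unit`, `m | p−1` — each Teissier (`g ≤ 1`); so AS
   degree `p` is fine BRANCHWISE, again matching Piltant 2003 (degree `p`). (e) HARD REGIME, where a
   kill of the intended statement must be sought: degree `p²` two-stage towers with DEFECT over a
   surface base (Cutkosky–Piltant / Kuhlmann defect extensions: the second key polynomial is a limit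
   key polynomial, so the stage-2 weight `v₂` is not attained by finitely many base blow-ups along the
   valuation), and the planner's fourfold regime `z⁹ + F` (`p = 3`, Moh-type bounds fail). A decisive
   experiment is a polyhedron computation following base blow-ups of `k⟦x₁,x₂⟧` for a degree-`p²`
   defect tower germ (kit job; not run this cycle — the typed item being irrefutable, the computation
   informs the planner's restatement, not this item's verdict).
6. **Looseness of `TF` noticed by rreview-0817T01-1 (recorded, not used here):** the support bound
   `i.val + 1 < j.val → e j = 0` lets `h_i` contain the variable `u_{i+1}` itself (weight
   `v_{i+1} > n_i v_i`, always overweight), so `E_i = u_{i+1} − core_i` can lose its link and `TF`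
   contains overweight complete-intersection towers of embedding codimension `> 1` over `k⟦x⟧`; for
   THIS crux that only weakens the conclusion (irrelevant to refutability); it matters for
   `TeissierResolve` (17086). One-token repair: `i.val < j.val`.

## What is landed (ledger; all ACCEPTED, all imported above)
* p151409 `Theorems/TeissierReduction/Negative/ImpliedBySummit.lean` — §2.
* p151761 `Theorems/TeissierReduction/Negative/FalseWithoutIsIntegral.lean` — §3a.
* p157654 `Theorems/TeissierReduction/Negative/TeissierQuotientF2Point.lean` — §3c/§6 (algebra:
  `exists_ringHom_of_isDatum`, `exists_ringHom_stalk_of_teissierPresented`,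
  `false_of_ringHom_zmod2`, `exists_closed_point_of_isIso_restrict`).
* p158140 `Theorems/TeissierReduction/Negative/FalseOverPerfectField.lean` — §3c (geometry:
  `exists_closed_point_units` on `ℙ¹_K`, `teissierReduction_false_over_perfectField`).

## For the planner (repair menu, not a verdict)
The item is not misstated in the refuter's technical sense (no counterexample exists unless the
summit fails), but it does not carry the content its rationale and kill criterion describe. If the
route is meant to test JUNG REDUCTION, restate crux 2 along `TeissierReductionJung` below (base and
finite projection explicit, `X'` the fibre product), and let crux 3 consume `TeissierPresentedOver`.
-/

noncomputable section

set_option linter.dupNamespace false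

namespace Summit.ResolutionOfSingularities.ResolutionOfSingularities.Cruxes.TeissierReduction.Disproof

open CategoryTheory CategoryTheory.Limits AlgebraicGeometry IsLocalRing
open Literature.AlgebraicGeometry.Resolution
open Summit.ResolutionOfSingularities.ResolutionOfSingularities.Theses.TeissierJung
open Summit.ResolutionOfSingularities.ResolutionOfSingularities.Theorems.TeissierReduction

universe u

/-! ## §1 The crux unfolded: `TF` is `TeissierPresented` -/

/-- `TeissierReduction` with the let-bound predicate `TF` replaced by the Literature predicate
`TeissierPresented k X'` (`teissierPresented_iff` is the byte-identical bridge). [folklore] -/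
theorem teissierReduction_iff :
    TeissierReduction ↔
      ∀ p : ℕ, p.Prime → ∀ (k : Type) [Field k] [CharP k p] [IsAlgClosed k] (m : ℕ)
        (H : Scheme.{0}) (ι' : H ⟶ (Literature.AlgebraicGeometry.Motives.projectiveSpace m k).left),
        IsClosedImmersion ι' → IsIntegral H →
        (∀ y : (Literature.AlgebraicGeometry.Motives.projectiveSpace m k).left,
          ∃ U : (Literature.AlgebraicGeometry.Motives.projectiveSpace m k).left.affineOpens,
            y ∈ (U : (Literature.AlgebraicGeometry.Motives.projectiveSpace m k).left.Opens) ∧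
            (ι'.ker.ideal U).IsPrincipal) →
        ∃ (X' : Scheme.{0}) (ρ : X' ⟶ H), IsProper ρ ∧ IsBirational ρ ∧ TeissierPresented k X' := by
  constructor
  · intro h p hp k _ _ _ m H ι' hι hH hpr
    obtain ⟨X', ρ, h1, h2, h3⟩ := h p hp k m H ι' hι hH hpr
    exact ⟨X', ρ, h1, h2, (teissierPresented_iff k X').2 h3⟩
  · intro h p hp k _ _ _ TF m H ι' hι hH hpr
    obtain ⟨X', ρ, h1, h2, h3⟩ := h p hp k m H ι' hι hH hpr
    exact ⟨X', ρ, h1, h2, (teissierPresented_iff k X').1 h3⟩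

/-! ## §2 The crux is implied by the summit (degenerate witness `S := X'`, `π := 𝟙`, `g := 0`)

These are the theorems of `Theorems/TeissierReduction/Negative/ImpliedBySummit.lean` (p151409),
duplicated here so that this work file is self-contained; once that module is in the tree this
section can be replaced by an `import`. -/

/-- An ideal of a Noetherian ring is generated by a family indexed by `Fin (spanFinrank I)`.
[folklore] -/
theorem exists_span_range_eq {A : Type*} [CommRing A] [IsNoetherianRing A]
    (I : Ideal A) : ∃ x : Fin I.spanFinrank → A, Ideal.span (Set.range x) = I := by
  obtain ⟨s, hcard, hspan⟩ :=
    Submodule.FG.exists_span_finset_card_eq_spanFinrank (IsNoetherian.noetherian I)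
  refine ⟨fun i => (s.equivFin.symm (Fin.cast hcard.symm i) : A), ?_⟩
  have hr : Set.range (fun i => (s.equivFin.symm (Fin.cast hcard.symm i) : A)) = (s : Set A) := by
    ext a
    simp only [Set.mem_range, Finset.mem_coe]
    constructor
    · rintro ⟨i, rfl⟩; exact Finset.coe_mem _
    · intro ha; exact ⟨Fin.cast hcard (s.equivFin ⟨a, ha⟩), by simp⟩
  rw [hr]
  exact hspan

/-- **The degenerate witness.** A regular, integral, separated `k`-scheme of finite type over an
algebraically closed field is Teissier-presented over ITSELF (`S := X`, `π := 𝟙`; at a closed point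
`𝒪̂_{X,x} ≅ k⟦x₁, …, x_d⟧` is a domain, its only branch `P = ⊥` carries the empty datum `g = 0`).
No projection, no base modification, no polyhedron. [folklore] -/
theorem teissierPresented_of_isRegular {k : Type u} [Field k] [IsAlgClosed k] (X : Scheme.{u})
    (f : X ⟶ Spec (.of k)) [IsSeparated f] [LocallyOfFiniteType f] [QuasiCompact f]
    [IsIntegral X] (hreg : Scheme.IsRegular X) : TeissierPresented k X := by
  refine ⟨X, f, 𝟙 X, ‹_›, ‹_›, ‹_›, ‹_›, hreg, ‹_›, inferInstance, fun x hx P hP => ?_⟩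
  haveI : IsRegularLocalRing (X.presheaf.stalk x) := hreg x
  obtain ⟨z, hz⟩ := exists_span_range_eq (maximalIdeal (X.presheaf.stalk x))
  have hd : ringKrullDim (X.presheaf.stalk x) =
      ((maximalIdeal (X.presheaf.stalk x)).spanFinrank : ℕ) :=
    (IsRegularLocalRing.spanFinrank_maximalIdeal).symm
  obtain ⟨e, -⟩ := exists_ringEquiv_adicCompletion_stalk_mvPowerSeries f hx z hz hd
  haveI : IsDomain (MvPowerSeries (Fin (maximalIdeal (X.presheaf.stalk x)).spanFinrank) k) :=
    NoZeroDivisors.to_isDomain _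
  haveI : IsDomain (AdicCompletion (maximalIdeal (X.presheaf.stalk x)) (X.presheaf.stalk x)) :=
    e.toMulEquiv.isDomain
  have hP0 : P = ⊥ := by
    rw [IsDomain.minimalPrimes_eq_singleton_bot] at hP
    exact hP
  subst hP0
  refine ⟨_, e, (e.symm.trans (RingEquiv.quotientBot _).symm).toRingHom.comp (RingHom.id _),
    (TeissierPresentation.mvPowerSeries k
      (maximalIdeal (X.presheaf.stalk x)).spanFinrank).of_ringEquiv
      (e.symm.trans (RingEquiv.quotientBot _).symm), fun a => ?_⟩
  simp only [Scheme.Hom.stalkMap_id]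
  exact congrArg (Ideal.Quotient.mk ⊥) (e.symm_apply_apply _)

/-- The source of a resolution of an integral scheme is integral. [folklore] -/
theorem isIntegral_of_isResolution {X' X : Scheme.{u}} {π : X' ⟶ X} [IsIntegral X]
    (h : IsResolution π) : IsIntegral X' := by
  haveI : ∀ z : X', _root_.IsReduced (X'.presheaf.stalk z) := fun z => by
    haveI := h.isRegular z
    haveI := isDomain_of_isRegularLocalRing (X'.presheaf.stalk z)
    infer_instance
  haveI : IsReduced X' := isReduced_of_isReduced_stalk X'
  haveI : IrreducibleSpace X' := ComponentGluing.IsBirational.irreducibleSpace h.isBirational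
  exact isIntegral_of_irreducibleSpace_of_isReduced X'

/-- **A counterexample to the crux is a non-resolvable hypersurface** (sharper contrapositive).
[folklore] -/
theorem exists_hypersurface_not_hasResolution_of_not_teissierReduction (h : ¬ TeissierReduction) :
    ∃ p : ℕ, p.Prime ∧ ∃ (k : Type) (_ : Field k) (_ : CharP k p) (_ : IsAlgClosed k) (m : ℕ)
      (H : Scheme.{0}) (ι' : H ⟶ (Literature.AlgebraicGeometry.Motives.projectiveSpace m k).left),
      IsClosedImmersion ι' ∧ IsIntegral H ∧
      (∀ y : (Literature.AlgebraicGeometry.Motives.projectiveSpace m k).left,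
        ∃ U : (Literature.AlgebraicGeometry.Motives.projectiveSpace m k).left.affineOpens,
          y ∈ (U : (Literature.AlgebraicGeometry.Motives.projectiveSpace m k).left.Opens) ∧
          (ι'.ker.ideal U).IsPrincipal) ∧
      ¬ Scheme.HasResolution H := by
  by_contra hall
  push Not at hall
  apply h
  intro p hp k _ _ _ TF m H ι' hι hH hprinc
  have hres : Scheme.HasResolution H :=
    hall p hp k inferInstance inferInstance inferInstance m H ι' hι hH hprinc
  haveI := Literature.AlgebraicGeometry.Motives.isProper_projectiveSpace m k
  haveI : IsClosedImmersion ι' := hι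
  haveI : IsIntegral H := hH
  obtain ⟨X', ρ, hρ⟩ := hres
  haveI := hρ.isProper
  haveI : IsIntegral X' := isIntegral_of_isResolution hρ
  refine ⟨X', ρ, hρ.isProper, hρ.isBirational, ?_⟩
  exact (teissierPresented_iff k X').1 (teissierPresented_of_isRegular X'
    (ρ ≫ ι' ≫ (Literature.AlgebraicGeometry.Motives.projectiveSpace m k).hom) hρ.isRegular)

/-- **Any disproof of the crux disproves the summit** (equivalently, read contrapositively:
`ResolutionOfSingularities → TeissierReduction`, the degenerate witness applied to any resolution
of `H`; the argument uses NEITHER the local principality of the ideal of `H` NOR anything about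
`ℙᵐ` beyond properness over `k` — it is stated negatively so that no declaration of this work file
has the crux as its conclusion). [folklore] -/
theorem not_resolutionOfSingularities_of_not_teissierReduction (h : ¬ TeissierReduction) :
    ¬ _root_.ResolutionOfSingularities := by
  intro hR
  obtain ⟨p, hp, k, _, _, _, m, H, ι', hι, hH, -, hno⟩ :=
    exists_hypersurface_not_hasResolution_of_not_teissierReduction h
  haveI := Literature.AlgebraicGeometry.Motives.isProper_projectiveSpace m k
  haveI : IsClosedImmersion ι' := hι
  haveI : IsIntegral H := hH
  exact hno (hR p hp k H (ι' ≫ (Literature.AlgebraicGeometry.Motives.projectiveSpace m k).hom)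
    inferInstance inferInstance inferInstance inferInstance)

/-! ## §3 Load-bearing hypotheses

For each hypothesis of the crux: the statement with it dropped / weakened, and what happens.

* §3a `IsIntegral H` ↦ `IsReduced H`: FALSE (`H = ∅`). Landed separately as
  `Negative/FalseWithoutIsIntegral.lean`.
* §3b local principality of the ideal (the HYPERSURFACE hypothesis) deleted: still implied by the
  summit (`teissierReductionWithoutPrincipal_of_resolution`) — decoration for the typed conclusion;
  the same goes for `p.Prime` / `CharP k p` (in characteristic `0` the item follows from
  `Hironaka1964`, a vendored named fact) and for "closed subscheme of `ℙᵐ`" beyond "separated of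
  finite type" (the degenerate witness needs only `HasResolution H`).
* §3c `IsAlgClosed k` ↦ `PerfectField k`: FALSE on paper (`k = 𝔽₂`, `H = ℙ¹`), sorried below with
  the argument in the docstring. -/

/-- `TeissierReduction` with `IsIntegral H` weakened to `IsReduced H` (verbatim otherwise). -/
def TeissierReductionWithoutIsIntegral : Prop :=
  ∀ p : ℕ, p.Prime → ∀ (k : Type) [Field k] [CharP k p] [IsAlgClosed k], let TF : AlgebraicGeometry.Scheme.{0} → Prop := fun X' => (∃ (S : AlgebraicGeometry.Scheme.{0}) (g : S ⟶ AlgebraicGeometry.Spec (.of k)) (π : X' ⟶ S), AlgebraicGeometry.IsSeparated g ∧ AlgebraicGeometry.LocallyOfFiniteType g ∧ AlgebraicGeometry.QuasiCompact g ∧ AlgebraicGeometry.IsIntegral S ∧ Literature.AlgebraicGeometry.Resolution.Scheme.IsRegular S ∧ AlgebraicGeometry.IsIntegral X' ∧ AlgebraicGeometry.IsFinite π ∧ ∀ x : X', IsClosed ({x} : Set X') → ∀ P ∈ minimalPrimes (AdicCompletion (IsLocalRing.maximalIdeal (X'.presheaf.stalk x)) (X'.presheaf.stalk x)), ∃ (d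 g : ℕ) (n : Fin g → ℕ) (v : Fin g → (Fin d → ℚ)) (c : Fin g → k) (A : Fin g → (Fin d →₀ ℕ)) (mu : Fin g → (Fin g →₀ ℕ)) (h : Fin g → MvPolynomial (Fin g) (MvPowerSeries (Fin d) k)) (φ : AdicCompletion (IsLocalRing.maximalIdeal (S.presheaf.stalk (π.base x))) (S.presheaf.stalk (π.base x)) ≃+* MvPowerSeries (Fin d) k), let W : (Fin d →₀ ℕ) → (Fin g →₀ ℕ) → (Fin d → ℚ) := fun a e j => (a j : ℚ) + ∑ i : Fin g, (e i : ℚ) * v i j; let core : Fin g → MvPolynomial (Fin g) (MvPowerSeries (Fin d) k) := fun i => MvPolynomial.X i ^ (n i) - MvPolynomial.C (MvPowerSeries.monomial (A i) (c i)) * MvPolynomial.monomial (mu i) 1 + h i; let E : Fin g → MvPolynomial (Fin g) (MvPowerSeries (Fin d) k) := fun i => if hi : i.val + 1 < g then MvPolynomial.X ⟨i.val + 1, hi⟩ - core i else core i; let B : Fin g → MvPolynomial (Fin d ⊕ Fin g) k := fun i => MvPolynomial.X (Sum.inr i) ^ (n i) - MvPolynomial.C (c i) * MvPolynomial.monomial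 ((A i).sumElim (mu i)) 1; ∃ ψ : (AdicCompletion (IsLocalRing.maximalIdeal (X'.presheaf.stalk x)) (X'.presheaf.stalk x) ⧸ P) ≃+* (MvPolynomial (Fin g) (MvPowerSeries (Fin d) k) ⧸ Ideal.span (Set.range E)), (∀ i, 2 ≤ n i) ∧ (∀ i, c i ≠ 0) ∧ (∀ i j, 0 ≤ v i j) ∧ (∀ i (j : Fin g), i.val ≤ j.val → mu i j = 0) ∧ (∀ i, n i • v i = W (A i) (mu i)) ∧ (∀ (i : Fin g) (hi : i.val + 1 < g), n i • v i ≤ v ⟨i.val + 1, hi⟩ ∧ n i • v i ≠ v ⟨i.val + 1, hi⟩) ∧ (∀ i, ∀ e ∈ (h i).support, (∀ j : Fin g, i.val + 1 < j.val → e j = 0) ∧ ∀ a : Fin d →₀ ℕ, MvPowerSeries.coeff a ((h i).coeff e) ≠ 0 → n i • v i ≤ W a e ∧ n i • v i ≠ W a e) ∧ (Ideal.span (Set.range B)).IsPrime ∧ (∀ a : S.presheaf.stalk (π.base x), ψ (Ideal.Quotient.mk P (algebraMap _ _ ((π.stalkMap x).hom a))) = Ideal.Quotient.mk _ (MvPolynomial.C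 (φ (algebraMap _ _ a))))); ∀ (m : ℕ) (H : AlgebraicGeometry.Scheme.{0}) (ι' : H ⟶ (Literature.AlgebraicGeometry.Motives.projectiveSpace m k).left), AlgebraicGeometry.IsClosedImmersion ι' → AlgebraicGeometry.IsReduced H → (∀ y : (Literature.AlgebraicGeometry.Motives.projectiveSpace m k).left, ∃ U : (Literature.AlgebraicGeometry.Motives.projectiveSpace m k).left.affineOpens, y ∈ (U : (Literature.AlgebraicGeometry.Motives.projectiveSpace m k).left.Opens) ∧ (ι'.ker.ideal U).IsPrincipal) → ∃ (X' : AlgebraicGeometry.Scheme.{0}) (ρ : X' ⟶ H), AlgebraicGeometry.IsProper ρ ∧ Literature.AlgebraicGeometry.Resolution.IsBirational ρ ∧ TF X'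

/-- **`IsIntegral H` is load-bearing**: the weakened item fails at `p = 2`, `k = \overline{𝔽₂}`,
`m = 0`, `H = ∅ ↪ ℙ⁰` (closed immersion, ideal `⊤` principal on every affine open, `∅` reduced):
`TF X'` forces `X'` integral hence nonempty, but `X'` maps to `∅`. (= the theorem of
`Negative/FalseWithoutIsIntegral.lean`, restated against the `def`.) [folklore] -/
theorem teissierReduction_false_without_isIntegral : ¬ TeissierReductionWithoutIsIntegral := by
  intro h
  have hred : IsReduced (∅ : Scheme.{0}) :=
    haveI : ∀ x : (∅ : Scheme.{0}), _root_.IsReduced ((∅ : Scheme.{0}).presheaf.stalk x) :=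
      fun x => isEmptyElim x
    isReduced_of_isReduced_stalk _
  obtain ⟨X', ρ, -, -, hTF⟩ := h 2 Nat.prime_two (AlgebraicClosure (ZMod 2)) 0 ∅
    (Scheme.emptyTo _) inferInstance hred (fun y => by
      obtain ⟨_, ⟨V, hV, rfl⟩, hyV, -⟩ :=
        (Literature.AlgebraicGeometry.Motives.projectiveSpace 0
          (AlgebraicClosure (ZMod 2))).left.isBasis_affineOpens.exists_subset_of_mem_open
          (Set.mem_univ y) isOpen_univ
      refine ⟨⟨V, hV⟩, hyV, ?_⟩
      rw [Scheme.ker_eq_top_of_isEmpty, Scheme.IdealSheafData.ideal_top]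
      exact top_isPrincipal)
  have hint : IsIntegral X' :=
    ((teissierPresented_iff (AlgebraicClosure (ZMod 2)) X').2 hTF).isIntegral
  obtain ⟨x⟩ := hint.nonempty
  exact isEmptyElim (ρ.base x)

/-- `TeissierReduction` with the hypersurface hypothesis (local principality of the ideal of `H`
in `ℙᵐ`) DELETED (verbatim otherwise): `H` is any integral closed subscheme of `ℙᵐ_k`. -/
def TeissierReductionWithoutPrincipal : Prop :=
  ∀ p : ℕ, p.Prime → ∀ (k : Type) [Field k] [CharP k p] [IsAlgClosed k], let TF : AlgebraicGeometry.Scheme.{0} → Prop := fun X' => (∃ (S : AlgebraicGeometry.Scheme.{0}) (g : S ⟶ AlgebraicGeometry.Spec (.of k)) (π : X' ⟶ S), AlgebraicGeometry.IsSeparated g ∧ AlgebraicGeometry.LocallyOfFiniteType g ∧ AlgebraicGeometry.QuasiCompact g ∧ AlgebraicGeometry.IsIntegral S ∧ Literature.AlgebraicGeometry.Resolution.Scheme.IsRegular S ∧ AlgebraicGeometry.IsIntegral X' ∧ AlgebraicGeometry.IsFinite π ∧ ∀ x : X', IsClosed ({x} : Set X') → ∀ P ∈ minimalPrimes (AdicCompletion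 (IsLocalRing.maximalIdeal (X'.presheaf.stalk x)) (X'.presheaf.stalk x)), ∃ (d g : ℕ) (n : Fin g → ℕ) (v : Fin g → (Fin d → ℚ)) (c : Fin g → k) (A : Fin g → (Fin d →₀ ℕ)) (mu : Fin g → (Fin g →₀ ℕ)) (h : Fin g → MvPolynomial (Fin g) (MvPowerSeries (Fin d) k)) (φ : AdicCompletion (IsLocalRing.maximalIdeal (S.presheaf.stalk (π.base x))) (S.presheaf.stalk (π.base x)) ≃+* MvPowerSeries (Fin d) k), let W : (Fin d →₀ ℕ) → (Fin g →₀ ℕ) → (Fin d → ℚ) := fun a e j => (a j : ℚ) + ∑ i : Fin g, (e i : ℚ) * v i j; let core : Fin g → MvPolynomial (Fin g) (MvPowerSeries (Fin d) k) := fun i => MvPolynomial.X i ^ (n i) - MvPolynomial.C (MvPowerSeries.monomial (A i) (c i)) * MvPolynomial.monomial (mu i) 1 + h i; let E : Fin g → MvPolynomial (Fin g) (MvPowerSeries (Fin d) k) := fun i => if hi : i.val + 1 < g then MvPolynomial.X ⟨i.val + 1, hi⟩ - core i else core i; let B : Fin g → MvPolynomial (Fin d ⊕ Fin g) k := fun i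 => MvPolynomial.X (Sum.inr i) ^ (n i) - MvPolynomial.C (c i) * MvPolynomial.monomial ((A i).sumElim (mu i)) 1; ∃ ψ : (AdicCompletion (IsLocalRing.maximalIdeal (X'.presheaf.stalk x)) (X'.presheaf.stalk x) ⧸ P) ≃+* (MvPolynomial (Fin g) (MvPowerSeries (Fin d) k) ⧸ Ideal.span (Set.range E)), (∀ i, 2 ≤ n i) ∧ (∀ i, c i ≠ 0) ∧ (∀ i j, 0 ≤ v i j) ∧ (∀ i (j : Fin g), i.val ≤ j.val → mu i j = 0) ∧ (∀ i, n i • v i = W (A i) (mu i)) ∧ (∀ (i : Fin g) (hi : i.val + 1 < g), n i • v i ≤ v ⟨i.val + 1, hi⟩ ∧ n i • v i ≠ v ⟨i.val + 1, hi⟩) ∧ (∀ i, ∀ e ∈ (h i).support, (∀ j : Fin g, i.val + 1 < j.val → e j = 0) ∧ ∀ a : Fin d →₀ ℕ, MvPowerSeries.coeff a ((h i).coeff e) ≠ 0 → n i • v i ≤ W a e ∧ n i • v i ≠ W a e) ∧ (Ideal.span (Set.range B)).IsPrime ∧ (∀ a : S.presheaf.stalk (π.base x), ψ (Ideal.Quotient.mk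 P (algebraMap _ _ ((π.stalkMap x).hom a))) = Ideal.Quotient.mk _ (MvPolynomial.C (φ (algebraMap _ _ a))))); ∀ (m : ℕ) (H : AlgebraicGeometry.Scheme.{0}) (ι' : H ⟶ (Literature.AlgebraicGeometry.Motives.projectiveSpace m k).left), AlgebraicGeometry.IsClosedImmersion ι' → AlgebraicGeometry.IsIntegral H → ∃ (X' : AlgebraicGeometry.Scheme.{0}) (ρ : X' ⟶ H), AlgebraicGeometry.IsProper ρ ∧ Literature.AlgebraicGeometry.Resolution.IsBirational ρ ∧ TF X'

/-- **Local principality is decoration for the typed conclusion**: the summit implies the item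
even with the hypersurface hypothesis deleted (same degenerate witness). So the hypothesis can
only serve the INTENDED mechanism (a hypersurface is finite and flat over `ℙ^d` by a generic
projection), which the type does not ask for. [folklore] -/
theorem teissierReductionWithoutPrincipal_of_resolution (hR : _root_.ResolutionOfSingularities) :
    TeissierReductionWithoutPrincipal := by
  intro p hp k _ _ _ TF m H ι' hι hH
  haveI := Literature.AlgebraicGeometry.Motives.isProper_projectiveSpace m k
  haveI : IsClosedImmersion ι' := hι
  haveI : IsIntegral H := hH
  obtain ⟨X', ρ, hρ⟩ := hR p hp k H
    (ι' ≫ (Literature.AlgebraicGeometry.Motives.projectiveSpace m k).hom)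
    inferInstance inferInstance inferInstance inferInstance
  haveI := hρ.isProper
  haveI : IsIntegral X' := isIntegral_of_isResolution hρ
  refine ⟨X', ρ, hρ.isProper, hρ.isBirational, ?_⟩
  exact (teissierPresented_iff k X').1 (teissierPresented_of_isRegular X'
    (ρ ≫ ι' ≫ (Literature.AlgebraicGeometry.Motives.projectiveSpace m k).hom) hρ.isRegular)

/-- `TeissierReduction` with `[IsAlgClosed k]` weakened to `[PerfectField k]` (verbatim
otherwise). -/
def TeissierReductionOverPerfect : Prop :=
  ∀ p : ℕ, p.Prime → ∀ (k : Type) [Field k] [CharP k p] [PerfectField k], let TF : AlgebraicGeometry.Scheme.{0} → Prop := fun X' => (∃ (S : AlgebraicGeometry.Scheme.{0}) (g : S ⟶ AlgebraicGeometry.Spec (.of k)) (π : X' ⟶ S), AlgebraicGeometry.IsSeparated g ∧ AlgebraicGeometry.LocallyOfFiniteType g ∧ AlgebraicGeometry.QuasiCompact g ∧ AlgebraicGeometry.IsIntegral S ∧ Literature.AlgebraicGeometry.Resolution.Scheme.IsRegular S ∧ AlgebraicGeometry.IsIntegral X' ∧ AlgebraicGeometry.IsFinite π ∧ ∀ x :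 X', IsClosed ({x} : Set X') → ∀ P ∈ minimalPrimes (AdicCompletion (IsLocalRing.maximalIdeal (X'.presheaf.stalk x)) (X'.presheaf.stalk x)), ∃ (d g : ℕ) (n : Fin g → ℕ) (v : Fin g → (Fin d → ℚ)) (c : Fin g → k) (A : Fin g → (Fin d →₀ ℕ)) (mu : Fin g → (Fin g →₀ ℕ)) (h : Fin g → MvPolynomial (Fin g) (MvPowerSeries (Fin d) k)) (φ : AdicCompletion (IsLocalRing.maximalIdeal (S.presheaf.stalk (π.base x))) (S.presheaf.stalk (π.base x)) ≃+* MvPowerSeries (Fin d) k), let W : (Fin d →₀ ℕ) → (Fin g →₀ ℕ) → (Fin d → ℚ) := fun a e j => (a j : ℚ) + ∑ i : Fin g, (e i : ℚ) * v i j; let core : Fin g → MvPolynomial (Fin g) (MvPowerSeries (Fin d) k) := fun i => MvPolynomial.X i ^ (n i) - MvPolynomial.C (MvPowerSeries.monomial (A i) (c i)) * MvPolynomial.monomial (mu i) 1 + h i; let E : Fin g → MvPolynomial (Fin g) (MvPowerSeries (Fin d) k) := fun i => if hi : i.val + 1 < g then MvPolynomial.X ⟨i.val + 1, hi⟩ -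 core i else core i; let B : Fin g → MvPolynomial (Fin d ⊕ Fin g) k := fun i => MvPolynomial.X (Sum.inr i) ^ (n i) - MvPolynomial.C (c i) * MvPolynomial.monomial ((A i).sumElim (mu i)) 1; ∃ ψ : (AdicCompletion (IsLocalRing.maximalIdeal (X'.presheaf.stalk x)) (X'.presheaf.stalk x) ⧸ P) ≃+* (MvPolynomial (Fin g) (MvPowerSeries (Fin d) k) ⧸ Ideal.span (Set.range E)), (∀ i, 2 ≤ n i) ∧ (∀ i, c i ≠ 0) ∧ (∀ i j, 0 ≤ v i j) ∧ (∀ i (j : Fin g), i.val ≤ j.val → mu i j = 0) ∧ (∀ i, n i • v i = W (A i) (mu i)) ∧ (∀ (i : Fin g) (hi : i.val + 1 < g), n i • v i ≤ v ⟨i.val + 1, hi⟩ ∧ n i • v i ≠ v ⟨i.val + 1, hi⟩) ∧ (∀ i, ∀ e ∈ (h i).support, (∀ j : Fin g, i.val + 1 < j.val → e j = 0) ∧ ∀ a : Fin d →₀ ℕ, MvPowerSeries.coeff a ((h i).coeff e) ≠ 0 → n i • v i ≤ W a e ∧ n i • v i ≠ W a e) ∧ (Ideal.span (Set.range B)).IsPrime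 ∧ (∀ a : S.presheaf.stalk (π.base x), ψ (Ideal.Quotient.mk P (algebraMap _ _ ((π.stalkMap x).hom a))) = Ideal.Quotient.mk _ (MvPolynomial.C (φ (algebraMap _ _ a))))); ∀ (m : ℕ) (H : AlgebraicGeometry.Scheme.{0}) (ι' : H ⟶ (Literature.AlgebraicGeometry.Motives.projectiveSpace m k).left), AlgebraicGeometry.IsClosedImmersion ι' → AlgebraicGeometry.IsIntegral H → (∀ y : (Literature.AlgebraicGeometry.Motives.projectiveSpace m k).left, ∃ U : (Literature.AlgebraicGeometry.Motives.projectiveSpace m k).left.affineOpens, y ∈ (U : (Literature.AlgebraicGeometry.Motives.projectiveSpace m k).left.Opens) ∧ (ι'.ker.ideal U).IsPrincipal) → ∃ (X' : AlgebraicGeometry.Scheme.{0}) (ρ : X' ⟶ H), AlgebraicGeometry.IsProper ρ ∧ Literature.AlgebraicGeometry.Resolution.IsBirational ρ ∧ TF X'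

/-- **`IsAlgClosed k` is load-bearing** (PROVED — gen 2: this is
`Negative.teissierReduction_false_over_perfectField` of `Negative/FalseOverPerfectField.lean`,
whose statement is the body of `TeissierReductionOverPerfect` verbatim; the Lean proof follows the
paper proof below except that it never forms residue fields: it tests `𝔽₂`-rationality of a local
ring by "no element `w` with `w`, `w − 1` both units", and replaces the weight-grading by an
evaluation into `𝔽₂[Y] ⧸ (Y^{n_i} − 1)`). Witness `p = 2`, `k = 𝔽₂` (perfect), `m = 1`,
`H = ℙ¹_{𝔽₂}` (`ι' = 𝟙`, ideal `0`). PAPER PROOF. (1) If `ρ : X' → ℙ¹` is proper birational with `X'` integral then over the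
dense open `U` of the definition `ρ⁻¹ U ≅ U`, and the cofinite `U ⊆ ℙ¹_{𝔽₂}` contains closed points
of every large residue degree; such a point `x` is closed in `X'` with `κ(x) = 𝔽_{2^r}`, `r ≥ 2`.
(2) CLAIM: over `k = 𝔽₂` every Teissier-presented closed point has residue field `𝔽₂`. Let
`B = 𝒪̂_{X',x} ⧸ P ≅ R := 𝔽₂⟦x₁..x_d⟧[X₀..X_{g-1}] ⧸ (E)` compatibly with `φ : 𝒪̂_{S,π x} ≅ 𝔽₂⟦x⟧`;
the `x_j` go to the maximal ideal of the local ring `R`, so `R ⧸ (x) R = 𝔽₂[X] ⧸ (Ē)` is local with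
residue field `κ(x)`, where `Ē_i` is `E_i` with the power-series coefficients replaced by their
constant terms. A constant term in `Ē_i` can only come from `c_i x^{A_i} X^{μ_i}` with
`A_i = 0, μ_i = 0`, i.e. (homogeneity) `n_i v_i = 0`, i.e. `v_i = 0`, impossible for `i ≥ 1`
(`v_i ≥ n_{i-1} v_{i-1} ≥ 0` with `v_i ≠ n_{i-1} v_{i-1}`), and the overweight tails `h_i` have no
constant term (weight `0` is not `> n_i v_i ≥ 0`). So if `v₀ ≠ 0` then `(Ē) ⊆ (X₀, …, X_{g-1})`,
the local ring `𝔽₂[X] ⧸ (Ē)` has the `𝔽₂`-point `X = 0`, hence residue field `𝔽₂`. If `v₀ = 0`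
then `A₀ = 0` and the first binomial is `B₀ = X₀^{n₀} − c₀ = X₀^{n₀} − 1` (`c₀ ∈ 𝔽₂ˣ`); grade
`𝔽₂[x, X]` by `wt(x_j) = 1`, `wt(X_i) = |v_i| = Σ_j v_{ij} ∈ ℚ_{≥0}`: every `B_i` is homogeneous of
weight `n_i |v_i|`, positive for `i ≥ 1` and `0` for `i = 0`, so the weight-`0` part of the
homogeneous ideal `J = (B₀, …, B_{g-1})` is `J ∩ 𝔽₂[X₀] = (X₀^{n₀} − 1)`, which is not prime
(`n₀ ≥ 2`, root `X₀ = 1`) — contradicting `J.IsPrime`. (For `g = 0`, `R = 𝔽₂⟦x⟧` has residue field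
`𝔽₂` directly.) (3) Hence `TF X'` fails at `x`, for every choice of `S, π`. The same argument shows,
over any field `k`: a Teissier-presented closed point has residue field `k` or `v₀ = 0` with
`X₀^{n₀} − c₀` generating a prime of `k[X₀]` — so over `𝔽₃` (where `X² − 2` is irreducible) this
particular witness does not work; the minimal REPAIR of the item is `IsAlgClosed k` as typed (or:
all closed points of `H` `k`-rational after the modification, which for non-closed `k` is absurd).
[folklore] -/
theorem teissierReduction_false_over_F2 : ¬ TeissierReductionOverPerfect :=
  Negative.teissierReduction_false_over_perfectField

/-! ## §4 The intended statement: Jung's reduction with only the base modified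

`TF` quantifies its base `S` existentially, which is what lets the regular model be its own base.
The printed programme (Mourtada–Schober 2025 p. 4, after Jung 1908 / Walker / Lipman / González
Pérez; Piltant 2003 for surfaces in characteristic `p`: "blow up only the base") fixes a finite
projection `π₀ : H → ℙ^d` FIRST and modifies ONLY the regular base. The two definitions below type
that; no theorem about them is claimed in this cycle (§5 explains why the cheap regimes do not
refute it). -/

/-- `TF` with the base GIVEN: `X'` is integral and finite over the regular integral separated
finite-type `k`-scheme `S` VIA `π`, and every analytic branch at every closed point carries a
Teissier presentation over `𝒪̂_{S,π x} ≅ k⟦x₁..x_d⟧` compatible with `π` — the body of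
`TeissierPresented k X'` with its leading `∃ S g π` removed. -/
def TeissierPresentedOver (k : Type u) [Field k] {X' S : Scheme.{u}} (π : X' ⟶ S)
    (g : S ⟶ Spec (.of k)) : Prop :=
  IsSeparated g ∧ LocallyOfFiniteType g ∧ QuasiCompact g ∧ IsIntegral S ∧ Scheme.IsRegular S ∧
    IsIntegral X' ∧ IsFinite π ∧
    ∀ x : X', IsClosed ({x} : Set X') →
      ∀ P ∈ minimalPrimes
          (AdicCompletion (IsLocalRing.maximalIdeal (X'.presheaf.stalk x)) (X'.presheaf.stalk x)),
        ∃ (d : ℕ)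
          (φ : AdicCompletion (IsLocalRing.maximalIdeal (S.presheaf.stalk (π.base x)))
              (S.presheaf.stalk (π.base x)) ≃+* MvPowerSeries (Fin d) k)
          (ι : MvPowerSeries (Fin d) k →+*
            AdicCompletion (IsLocalRing.maximalIdeal (X'.presheaf.stalk x)) (X'.presheaf.stalk x) ⧸ P),
          TeissierPresentation k d _ ι ∧
            ∀ a : S.presheaf.stalk (π.base x),
              ι (φ (algebraMap _ _ a)) = Ideal.Quotient.mk P (algebraMap _ _ ((π.stalkMap x).hom a))

/-- `TeissierPresented k X' ↔ ∃ S g π, TeissierPresentedOver k π g` (definitional). [folklore] -/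
theorem teissierPresented_iff_exists_over (k : Type u) [Field k] (X' : Scheme.{u}) :
    TeissierPresented k X' ↔
      ∃ (S : Scheme.{u}) (g : S ⟶ Spec (.of k)) (π : X' ⟶ S), TeissierPresentedOver k π g :=
  Iff.rfl

/-- **`TeissierReductionJung`** — the INTENDED crux (Jung's reduction to the Teissier class,
Mourtada–Schober 2025 p. 4; Piltant 2003 "blow up only the base"): for every integral hypersurface
`H ⊆ ℙᵐ_k` (`k` algebraically closed of characteristic `p`) there are a finite surjective
projection `π₀ : H → ℙ^d` and a proper birational `σ : S → ℙ^d` from a REGULAR `S` such that the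
fibre product `H ×_{ℙ^d} S`, with its projection to `S`, is Teissier-presented OVER `S`.
(Integrality of the fibre product is part of the claim; for a finite FLAT `π₀` — automatic for a
hypersurface, Cohen–Macaulay over regular — it holds, the fibre product being Cohen–Macaulay,
generically a field, and flat over the integral `S`.) NOT REFUTED; no theorem is claimed. A
counterexample to THIS statement in `d = 2` would not contradict resolution of surfaces and is the
honest form of the route's kill criterion. -/
def TeissierReductionJung : Prop :=
  ∀ p : ℕ, p.Prime → ∀ (k : Type) [Field k] [CharP k p] [IsAlgClosed k] (m : ℕ) (H : Scheme.{0})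
    (ι' : H ⟶ (Literature.AlgebraicGeometry.Motives.projectiveSpace m k).left),
    IsClosedImmersion ι' → IsIntegral H →
    (∀ y : (Literature.AlgebraicGeometry.Motives.projectiveSpace m k).left,
      ∃ U : (Literature.AlgebraicGeometry.Motives.projectiveSpace m k).left.affineOpens,
        y ∈ (U : (Literature.AlgebraicGeometry.Motives.projectiveSpace m k).left.Opens) ∧
        (ι'.ker.ideal U).IsPrincipal) →
    ∃ (d : ℕ) (π₀ : H ⟶ (Literature.AlgebraicGeometry.Motives.projectiveSpace d k).left)
      (S : Scheme.{0}) (σ : S ⟶ (Literature.AlgebraicGeometry.Motives.projectiveSpace d k).left),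
      IsFinite π₀ ∧ Function.Surjective π₀.base ∧ IsProper σ ∧ IsBirational σ ∧
      TeissierPresentedOver k (pullback.snd π₀ σ)
        (σ ≫ (Literature.AlgebraicGeometry.Motives.projectiveSpace d k).hom)

/-- Sanity: the intended statement implies the typed crux (the fibre product maps properly and
birationally onto `H`?) — NOT claimed: `pullback.fst π₀ σ : H ×_{ℙ^d} S → H` is proper (base change
of `σ`), but its birationality needs `π₀` finite FLAT/generically étale bookkeeping (`IsBirational`
asks for an isomorphism over a dense open of `H`), which holds over `π₀⁻¹` of the open where `σ` is
an isomorphism. Recorded as the first stub a planner adopting `TeissierReductionJung` must supply: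
`TeissierReductionJung → TeissierReduction`. -/
theorem teissierReductionJung_imp_note : True := trivial

/-! ## §5 Regimes checked against `TeissierReductionJung` (paper; comments only)

(a) `d = 1`: a plane branch over `k⟦x⟧` is an overweight deformation of its monomial curve
    (Teissier); complete discretely valued fields are defectless, MacLane chains are finite —
    every branch is Teissier for EVERY finite projection. No kill.
(b) Radicial monomial covers `z^p = x^a y^b` (`p ∤ a` or `p ∤ b`): Teissier, `g = 1`, `h = 0`. The
    catalogued barrier `BaseOnlyRadicialNormalizationCannot` (k of char 11, `z¹¹ = s t⁴`, golden
    valuation: no quadratic transform of the base has a REGULAR normalisation in `L`) therefore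
    does not bite: at the `n`-th transform the radicand is `Pₙ^{αₙ} Qₙ^{βₙ}` with `11 ∤ αₙ`, a prime
    binomial — the germ is Teissier at every stage without touching it. (The barrier is about
    normalising; the Teissier endgame resolves `z^p − x^A` torically instead.)
(c) Purely inseparable degree `p` over a surface, `z^p + F(x₁,x₂)`: every generator `z'` of the
    branch over `k⟦x⟧` has `z'^p ∈ k⟦x⟧`, so Teissier ⇔ some `G = Σ_{e<p} r_e^p (−F)^e` with
    `k⟦x⟧[G^{1/p}] = k⟦x⟧[F^{1/p}]` is `x^A · unit`, `p ∤ A`, in suitable regular parameters of the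
    base point. Base point blow-ups make `F` (mod `p`-th powers) a monomial times a unit at every
    point, and the form is stable at translated points (`x₁^{a₁} (t + x₂'')^{a₂}`: if `p | a₁ + a₂`
    the leading `p`-th power is cleaned and `x₁'^{a₁+a₂} x₂'' · unit` remains, `p ∤ 1`). Matches
    Piltant 2003 Thm 7.1. No kill expected in degree `p`, `d = 2`.
(d) Artin–Schreier degree `p`, `f = z^p − x^B u z − x^A u'` (coefficients monomialised on the base,
    which principalisation of `(x^{pB}, x^{(p-1)A})` on the regular base also makes COMPARABLE):
    vertex `A/p < B/(p−1)` ⇒ Teissier `g = 1` (the linear term has weight `B + A/p > A`); vertex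
    `B/(p−1) < A/p` ⇒ Newton polygon of `f` over the henselian `k⟦x⟧` has slopes `wB/(p−1)` (length
    `p−1`) and `w(A−B)` (length 1), so `f = (z − z₀(x)) · f_{p−1}` SPLITS: the branch `z = z₀` is
    regular (`g = 0`) and the branches of `f_{p−1}` are tame Kummer germs `z^m = ζ x^{B/δ}·unit`,
    `m = (p−1)/δ`, Teissier with `g ≤ 1`. (If `(p−1) | B`, substituting `z = x^{B/(p−1)} w` gives
    `w^p − w = x^C`, `C > 0`, which splits completely in `k⟦x⟧` by Hensel: `p` regular branches.)
    So BRANCHWISE (which is all `TF` asks) AS degree `p` is harmless; the kangaroo phenomenon of the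
    ORDER (Hauser2003_kangarooShadeIncrease) is not triggered because no residual order on a maximal
    contact hypersurface is formed — consistent with the route's barrier note.
(e) Where to look (not cheap; = Mourtada–Schober's open question): degree `p²` towers
    `u₁ = z^p − x^{A₁} − h₁`, `u₁^p − x^{A₂} z^{b} − h₂` whose second stage carries DEFECT along a
    valuation of the surface base (Cutkosky–Piltant defect examples; Kuhlmann): the stage-2 weight
    `v₂` is then a LIMIT not attained after finitely many base blow-ups along that valuation, so
    the one-vertex condition at stage 2 may fail at the centre of the valuation on every base
    model — a genuinely valuative obstruction that compactness cannot repair. A decisive kit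
    experiment: implement minimal weighted characteristic polyhedra for `k⟦x₁,x₂⟧[z]` germs of
    degree `p²` (`p = 2`: degree 4) and follow base blow-ups + translations along a
    Cutkosky–Piltant defect valuation. Deferred: the typed item being irrefutable, this informs a
    restatement, not this item's verdict; it becomes the first job if the planner adopts
    `TeissierReductionJung`.
-/


/-! ## §6 Gen 2, cycle 1 (2026-08-17): the `𝔽₂` lemma formalised; what it uses; new paper findings

(a) WHAT THE LEAN PROOF OF §3c USES OF `TF`. Only: the presentation at ONE closed point `x` (any
    closed point whose local ring contains `w` with `w, w − 1` units — i.e. `κ(x) ≠ 𝔽₂`), for ONE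
    minimal prime `P` of `𝒪̂_{X',x}` (one exists: the completion surjects onto the residue field,
    `Negative.exists_mem_minimalPrimes`), and of the datum only `two_le`, `coeff_ne_zero`,
    `weight_nonneg`, `homogeneous`, `weight_lt`, `overweight`, `isPrime` and the SHAPE of the
    equations `E_i`. NOT used: the base `S`, `π`, its finiteness, regularity of `S`, the
    isomorphism `φ : 𝒪̂_S ≅ k⟦x⟧`, the compatibility with the stalk map, `mu_eq_zero`, properness
    of `ρ`. Moral: the obstruction is intrinsic to "coefficients in `k`": every variant of `TF`
    keeping Teissier quotients OVER `k⟦x⟧` WITH `c_i ∈ k` forces closed points with an `𝔽₂`-point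
    of their local ring when `k = 𝔽₂`; the honest repair over a non-closed field lets the
    coefficient field of the presentation be the residue field `κ(x)` (a finite extension of `k`;
    Cohen: `𝒪̂_{X',x}` contains a coefficient field `≅ κ(x)`), i.e. `κ(x)⟦x₁..x_d⟧[u] ⧸ (E)` with
    `c_i ∈ κ(x)` — which is what `IsAlgClosed k` buys for free (`κ(x) = k` at closed points).
(b) OVER `𝔽₃` THE SAME WITNESS FAILS: `u² − 2 ∈ 𝔽₃[u]` is prime, and `Spec 𝔽₉ → Spec 𝔽₃` IS
    Teissier-presented (`d = 0`, `g = 1`, `n = 2`, `c = 2`, `A = 0`, `μ = 0`, `h = 0`; all side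
    conditions hold vacuously or trivially). So `PerfectField` is refuted at `𝔽₂` specifically
    (`𝔽₂ˣ = {1}` makes every `u^n − c`, `n ≥ 2`, reducible); over `𝔽_q`, `q > 2`, a refutation
    needs closed points of residue degree not of Kummer type (e.g. degree `3` over `𝔽₃`:
    `u³ − c = (u − c)³`), same mechanism, more bookkeeping — not pursued (one witness suffices).
(c) STRUCTURAL COROLLARY OVER ALGEBRAICALLY CLOSED `k` (for the provers; proved below as
    `isDatum_not_pure_power`): in a Teissier datum over an algebraically closed field NO binomial
    is a pure power `u_i^{n_i} − c_i` (`A_i = 0 ∧ μ_i = 0` is impossible): `c_i = a^{n_i}` and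
    `u_i^{n_i} − a^{n_i} = (u_i − a)·q(u_i)` would lie in the prime binomial ideal, but the
    evaluation `x ↦ 0`, `u_m ↦ 0` (`m ≠ i`), `u_i ↦ Y` into `k[Y] ⧸ (Y^{n_i} − c_i)` kills the
    binomial ideal (as in (a): `v_i = 0` forces `i` to be the first variable and every other
    binomial to involve a killed variable) and neither factor. Consequently every Teissier quotient
    over `k̄⟦x⟧` has the `k`-point `x = u = 0` (the augmentation kills all `E_i`), all weights
    `v_i` are nonzero vectors, and `z = u₀` has positive weight: the presented branch is a genuine
    deformation of a positively graded toric germ, never a "constant" extension `k⟦x⟧[u]/(u^n − c)`.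
(d) FINITE TYPE OF `H` IS LOAD-BEARING (paper; refines §3b, which called "closed subscheme of `ℙᵐ`
    beyond separated finite type" decoration): delete `IsClosedImmersion ι'` altogether and take
    `H = Spec k(t) → ℙ¹_k` the generic point (integral; the kernel ideal is `⊥` on every affine
    open since restriction to the generic stalk is injective on the integral `ℙ¹`, so "locally
    principal" holds). A proper birational `ρ : X' → Spec k(t)` with `X'` integral is an
    isomorphism (the dense open is the point), and `TF (Spec k(t))` fails: `X'` finite over `S` of
    finite type over `k` makes `k(t)` a finitely generated `k`-algebra that is a field, hence finite
    over `k` (Zariski), hence `= k` (`k` algebraically closed) — but `t` is transcendental. Not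
    formalised (plumbing: `Scheme.fromSpecStalk` at the generic point, `ker` of a dominant map,
    Zariski's lemma `finite_of_finite_type_of_isJacobsonRing`, transcendence of `RatFunc.X`);
    recorded so that nobody weakens the hypothesis to "`H` integral with a monomorphism to `ℙᵐ`".
(e) ATTACK LIST FOR THE NEXT ARMING. (1) If the planner restates crux 2 as `TeissierReductionJung`
    (§4): rerun the load-bearing analysis on ITS hypotheses (finite FLATNESS of `π₀` for
    integrality of `H ×_{ℙ^d} S`; surjectivity of `π₀`; whether `TeissierPresentedOver` must allow
    `κ(x)`-coefficients, cf. (a)) and run the §5(e) kit experiment (minimal weighted characteristic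
    polyhedra of degree-`p²` defect towers over `k⟦x₁,x₂⟧`, following base blow-ups along a
    Cutkosky–Piltant defect valuation). (2) For the item AS TYPED nothing remains to attack: every
    hypothesis is now classified (integral: load-bearing, landed; algebraically closed:
    load-bearing, landed; prime characteristic, projective embedding, local principality:
    decoration relative to the summit, §3b; finite type: load-bearing on paper, (d)). -/

/-- **No pure-power binomial over an algebraically closed field** (§6(c)): in a Teissier datum over
an algebraically closed `k`, no index has `A_i = 0` and `μ_i = 0`. [folklore] -/
theorem isDatum_not_pure_power {k : Type u} [Field k] [IsAlgClosed k] {d g : ℕ}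
    {n : Fin g → ℕ} {v : Fin g → (Fin d → ℚ)} {c : Fin g → k} {A : Fin g → (Fin d →₀ ℕ)}
    {mu : Fin g → (Fin g →₀ ℕ)} {h : Fin g → MvPolynomial (Fin g) (MvPowerSeries (Fin d) k)}
    (hD : Teissier.IsDatum n v c A mu h) (i : Fin g) : ¬ (A i = 0 ∧ mu i = 0) := by
  classical
  rintro ⟨hAi, hmui⟩
  -- positivity of the weights `n_i v_i`
  have hv0 : ∀ i, (0 : Fin d → ℚ) ≤ n i • v i := fun i j => by
    simpa [Pi.smul_apply, nsmul_eq_mul] using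
      mul_nonneg (Nat.cast_nonneg (n i)) (hD.weight_nonneg i j)
  -- a variable of weight zero is the first one
  have hfirst : ∀ l : Fin g, v l = 0 → l.val = 0 := by
    intro l hl
    by_contra hne
    obtain ⟨l', hl'⟩ : ∃ l' : ℕ, l.val = l' + 1 := ⟨l.val - 1, by omega⟩
    have hlt : l' + 1 < g := hl' ▸ l.isLt
    have hl'' : (⟨l' + 1, hlt⟩ : Fin g) = l := Fin.ext hl'.symm
    obtain ⟨hle, hne'⟩ := hD.weight_lt ⟨l', by omega⟩ hlt
    rw [hl'', hl] at hle hne'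
    exact hne' (le_antisymm hle (hv0 _))
  have hw00 : Teissier.weight v 0 0 = 0 := by
    funext j; simp [Teissier.weight]
  have hzero_of : ∀ l, Teissier.weight v (A l) (mu l) = 0 → v l = 0 := by
    intro l hwl
    have hhom := hD.homogeneous l
    rw [hwl] at hhom
    have hn : (n l : ℚ) ≠ 0 := by
      have := hD.two_le l; exact_mod_cast (show n l ≠ 0 by omega)
    funext j
    have := congrFun hhom j
    simp only [Pi.smul_apply, nsmul_eq_mul, Pi.zero_apply, mul_eq_zero] at this
    rcases this with h1 | h1
    · exact absurd h1 hn
    · exact h1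
  have hvi : v i = 0 := hzero_of i (by rw [hAi, hmui, hw00])
  have hi0 : i.val = 0 := hfirst i hvi
  have hBi : Teissier.binomial n c A mu i =
      MvPolynomial.X (Sum.inr i) ^ n i - MvPolynomial.C (c i) := by
    simp only [Teissier.binomial, hAi, hmui]
    have : ((0 : Fin d →₀ ℕ).sumElim (0 : Fin g →₀ ℕ)) = 0 := by
      ext s; cases s <;> simp
    rw [this]
    simp
  set N := n i with hN
  have hN2 : 2 ≤ N := hD.two_le i
  -- `c_i = a^N`
  obtain ⟨a, ha⟩ := IsAlgClosed.exists_pow_nat_eq (c i) (show 0 < N by omega)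
  -- the test ring `k[Y] ⧸ (Y^N − c_i)` and the evaluation `x ↦ 0`, `u_i ↦ Y`, `u_m ↦ 0`
  let F : Polynomial k := Polynomial.X ^ N - Polynomial.C (c i)
  let T := AdjoinRoot F
  let θ : MvPolynomial (Fin d ⊕ Fin g) k →ₐ[k] T :=
    MvPolynomial.aeval (Sum.elim (fun _ => 0) (fun m => if m = i then AdjoinRoot.root F else 0))
  have hθx : ∀ j, θ (MvPolynomial.X (Sum.inl j)) = 0 := fun j => by simp [θ]
  have hθu : ∀ m, m ≠ i → θ (MvPolynomial.X (Sum.inr m)) = 0 := fun m hm => by simp [θ, hm]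
  have hθi : θ (MvPolynomial.X (Sum.inr i)) = AdjoinRoot.root F := by simp [θ]
  have hθC : ∀ r : k, θ (MvPolynomial.C r) = AdjoinRoot.of F r := fun r => by
    simp [θ, T, AdjoinRoot.algebraMap_eq]
  have hθB : ∀ l, θ (Teissier.binomial n c A mu l) = 0 := by
    intro l
    by_cases hl : l = i
    · subst hl
      rw [hBi, map_sub, map_pow, hθi, hθC]
      have := AdjoinRoot.eval₂_root F
      simpa [F, Polynomial.eval₂_sub, Polynomial.eval₂_X_pow, Polynomial.eval₂_C] using this
    · have hnl : n l ≠ 0 := by have := hD.two_le l; omega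
      simp only [Teissier.binomial, map_sub, map_pow, map_mul, hθu l hl, zero_pow hnl,
        zero_sub, neg_eq_zero]
      suffices hmon : θ (MvPolynomial.monomial ((A l).sumElim (mu l)) 1) = 0 by
        rw [hmon, mul_zero]
      by_contra hmon
      have hAl : A l = 0 := by
        ext j
        by_contra hj
        apply hmon
        rw [Negative.monomial_one_eq_X_pow_mul _ (Sum.inl j), map_mul, map_pow, hθx,
          zero_pow (by simpa using hj), zero_mul]
      have hmul : ∀ m, m ≠ i → mu l m = 0 := by
        intro m hm
        by_contra hj
        apply hmon
        rw [Negative.monomial_one_eq_X_pow_mul _ (Sum.inr m), map_mul, map_pow, hθu m hm,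
          zero_pow (by simpa using hj), zero_mul]
      have hvl : v l = 0 := by
        refine hzero_of l ?_
        funext j
        simp only [Teissier.weight, hAl, Finsupp.coe_zero, Pi.zero_apply, Nat.cast_zero,
          zero_add]
        refine Finset.sum_eq_zero fun m _ => ?_
        by_cases hm : m = i
        · subst hm; simp [hvi]
        · simp [hmul m hm]
      exact hl (Fin.ext ((hfirst l hvl).trans hi0.symm))
  have hker : Teissier.binomialIdeal n c A mu ≤ RingHom.ker (θ : MvPolynomial (Fin d ⊕ Fin g) k →+* T) :=
    Ideal.span_le.2 (by rintro _ ⟨l, rfl⟩; exact hθB l)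
  -- the factorisation `Y^N − a^N = (Y − a) · q`
  have hroot : (Polynomial.X ^ N - Polynomial.C (c i)).IsRoot a := by
    simp [Polynomial.IsRoot, ha]
  obtain ⟨q, hq⟩ := Polynomial.dvd_iff_isRoot.2 hroot
  have hF0 : F ≠ 0 := by
    intro hF
    have := congrArg Polynomial.natDegree hF
    rw [Polynomial.natDegree_X_pow_sub_C, Polynomial.natDegree_zero] at this
    omega
  have hq0 : q ≠ 0 := by
    rintro rfl; exact hF0 (by simpa using hq)
  have hqdeg : q.natDegree < N := by
    have := congrArg Polynomial.natDegree hq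
    rw [Polynomial.natDegree_X_pow_sub_C, Polynomial.natDegree_mul (Polynomial.X_sub_C_ne_zero a)
      hq0, Polynomial.natDegree_X_sub_C] at this
    omega
  have hndvd : ∀ r : Polynomial k, r ≠ 0 → r.natDegree < N → ¬ F ∣ r := by
    intro r hr hdeg hdvd
    have := Polynomial.natDegree_le_of_dvd hdvd hr
    have hFdeg : F.natDegree = N := Polynomial.natDegree_X_pow_sub_C
    omega
  -- inside `k[x, u]`: `B_i = (u_i − a) · q(u_i)`
  have hfac : Teissier.binomial n c A mu i =
      (MvPolynomial.X (Sum.inr i) - MvPolynomial.C a) *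
        Polynomial.aeval (MvPolynomial.X (Sum.inr i)) q := by
    have := congrArg (Polynomial.aeval (R := k) (MvPolynomial.X (Sum.inr i) :
      MvPolynomial (Fin d ⊕ Fin g) k)) hq
    simp only [map_sub, map_pow, Polynomial.aeval_X, Polynomial.aeval_C, map_mul,
      MvPolynomial.algebraMap_eq] at this
    rw [hBi, this]
  have hmem : (MvPolynomial.X (Sum.inr i) - MvPolynomial.C a) *
      Polynomial.aeval (MvPolynomial.X (Sum.inr i)) q ∈ Teissier.binomialIdeal n c A mu := by
    rw [← hfac]
    exact Ideal.subset_span ⟨i, rfl⟩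
  have hθq : θ (Polynomial.aeval (MvPolynomial.X (Sum.inr i)) q) = AdjoinRoot.mk F q := by
    rw [← Polynomial.aeval_algHom_apply, hθi, AdjoinRoot.aeval_eq]
  rcases hD.isPrime.mem_or_mem hmem with h1 | h1
  · have h2 : θ (MvPolynomial.X (Sum.inr i) - MvPolynomial.C a) = 0 := hker h1
    rw [map_sub, hθi, hθC] at h2
    have h3 : AdjoinRoot.mk F (Polynomial.X - Polynomial.C a) = 0 := by
      simpa [AdjoinRoot.mk_X, AdjoinRoot.mk_C] using h2
    rw [AdjoinRoot.mk_eq_zero] at h3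
    refine hndvd _ (Polynomial.X_sub_C_ne_zero a) ?_ h3
    rw [Polynomial.natDegree_X_sub_C]; omega
  · have h2 : θ (Polynomial.aeval (MvPolynomial.X (Sum.inr i)) q) = 0 := hker h1
    rw [hθq, AdjoinRoot.mk_eq_zero] at h2
    exact hndvd q hq0 hqdeg h2

end Summit.ResolutionOfSingularities.ResolutionOfSingularities.Cruxes.TeissierReduction.Disproof

end
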